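/-
Copyright (c) 2026 the pub-hodgecm-mathlib formalisation cell (harness21).  Prover seat hodgecm-mathlib-K2E4-p10 (g10), Track B «K2-LIT»,
#184♮ = hLiu418 = `stmt-HodgeConjecture-24832`; socket #41 KIND W — THE ∃-CARRIER CM ASSEMBLER OVER LOCAL LETTERS: ★ p863329 (ii)′ `kindW_block_cm_of_letters` (K2E4-p11 (g9))
with its `hPart` slot REPLACED by ★ (x-a) ED. 4's letters via ★ `hPart_of_letters` (LEAD F0P6-plan (g14) BATCH #175 (1) «then (a) the one-line (ii)′ ∘ `hPart_of_letters` composition»).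
THEOREMS ONLY (no `def`, no `instance`, no notation, no named-fact hypothesis, no `sorry`).
-/
import Summits.HodgeConjecture.HodgeConjecture.Theorems.K2LiuKindWBlockOfRecordCMOfLetters         -- ★ p863329 (K2E4-p11 (g9)) (ii)′ `kindW_block_cm_of_letters`
import Summits.HodgeConjecture.HodgeConjecture.Theorems.K2LiuSiegelEisensteinKindWPartOfLetters    -- ★ p862818 (F0P2-p08 (g2)) `hPart_of_letters`
import HarnessLib

/-!
# Crux `HLiu418`, socket #41, KIND W — `K2LiuKindWBlockOfRecordCMOfLocalLetters`: THE KIND-W PAYER HEAD, CARRIERS BUILT INSIDE, `hJ hfsupp hfsize harch` DISCHARGED BY NAME,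
# AND THE HALF-PLANE IDENTITY `hPart` PAID BY ★ `hPart_of_letters` — every letter of the KIND-W block that has a ★ payer is discharged

Cell `hodgecm-mathlib`, crux item hLiu418 = `stmt-HodgeConjecture-24832` (helper lane `--supports … --as helper`, count-neutral), route of record `HCCMUnconditional`;
squad K2 ∕ K2Liu, road `K2_Liu`, socket #41 `sig_K2LiuSiegelEisensteinContinuation`, KIND W block (13 slots at ★ TOP ED. 17–20; consumer = K2E3-typ2 (g2)'s tie, KW desk
F0P2-p08 (g3)).  ★ p863329 `K2LiuKindWBlockOfRecordCMOfLetters.kindW_block_cm_of_letters` (K2E4-p11 (g9)) builds the carriers inside and discharges `hJ`, `hfsupp`, `hfsize`,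
`harch` by name, keeping the half-plane identity `hPart` BY VALUE; ★ p863299 `K2LiuSiegelEisensteinKindWOfRecordLocalLetters` (this seat) replaced `hPart` by ★ (x-a) ED. 4's
letters over ★ `kindW_block_of_record_local`.  THIS FILE is the one-line composition of the two roads (a sibling module: ★ (ii)′ is 257 lines, the head alone ≈ 150):
**`kindW_block_cm_of_localLetters`** — the binders of ★ `kindW_block_cm_of_letters` VERBATIM (socket prefix with `hlam`; inside the `∀`: `{fT} hfac`, then the block
`{m} FinfT FvT hsum hint Finf Ffin hFinfI hFfinI hFinf hFfin` (★ ED. 4 bytes, ED. 4 order) + `hFinf0`, IN PLACE OF `{m} Finf Ffin hFinf hFfin hFinf0 hPart`; then the (iii-fin)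
level ∕ size letters and the (iii-arch) frames + `hBL` unchanged); SAME ∃-carrier prefix and SAME 13-slot KIND-W conclusion.
Proof: projections of ★ `kindW_block_cm_of_letters` + `hPart := hPart_of_letters T₀ νinf hσ νv FinfT FvT hsum hint Finf Ffin hFinfI hFfinI`.
RESIDUE BY VALUE for the tie after this file (each with a named payer): (KW-fac) `fT hfac` + the Σ⊗ reading `FinfT FvT hsum` (K2E3-p26 `K2LiuKindWFactorizableDecomposition`);
the joint integrability `hint` (F0P2-p08 (x-a-int) `K2LiuKindWJointIntegrable` ⇐ `hintArch` K2Liu-p11 + (T1)-`hint` ★ p863303); `Finf hFinf hFinfI hFinf0` (LH4-p08∕LH4-p10: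
★ p863152 `K2LiuKindWArchLetterDefs`, ★ p863282); `Ffin hFfin hFfinI` (K2E3-p29: ★ p863154 `K2LiuKindWFiniteLetterDefs`); the (iii-fin) level ∕ size letters (K2E3-p29∕K2E3-p26);
the (iii-arch) frames + `hBL` (LH4-p08, K2E4-p11 (g9) «Φ6b-ind» `K2LiuKindWArchIndefiniteLetter`).
[CasselsFrohlichANT1967, Ch. XV (Tate) §3.3], [KudlaRallis1994, §1–§2], [Tan1999, §2–§4], [Shimura1982, §3], [Shimura1997, §18.4 Prop. 18.14, §19], [MoeglinWaldspurger1995, II.1.7, IV.1.9].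
HONEST LABEL.  Count-neutral helper; it retires nothing by itself: `HC_CM` is proved only modulo the 7 printed citations (2 remaining named inputs:
hLiu418 = `stmt-HodgeConjecture-24832`, h413 = `stmt-HodgeConjecture-24833`) until rung 0 closes.
-/

set_option autoImplicit false
set_option linter.dupNamespace false -- the mandated namespace repeats `HodgeConjecture.HodgeConjecture`

noncomputable section

open scoped Matrix BigOperators NNReal ENNReal ComplexConjugate RestrictedProduct
-- `Classical` is needed to see the Mathlib normed-ring instances on `mixedSpace L` (note H5 of ★ `AdelicGLnGlue`; as the TOP's `hτ`)
open scoped Classical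
open NumberField NumberField.InfinitePlace IsDedekindDomain MeasureTheory Measure
open Literature.NumberTheory.Automorphic Literature.NumberTheory.GaloisRepresentations Literature.NumberTheory.LFunctions
open Literature.NumberTheory.Automorphic.UnitaryGroup (archAt archPart archLocal)
open Literature.NumberTheory.GelbartRogawski1991 Literature.NumberTheory.GelbartRogawski1991.GRConstruction
open Literature.NumberTheory.K2Lit.SiegelDoubled Literature.NumberTheory.K2Lit.PlaceSplitting
open Literature.MeasureTheory.RestrictedProduct
open Literature.Topology.Algebra.RestrictedProduct (inH)
open Literature.NumberTheory.Automorphic.IdeleClassGroup (toHeckeCharacter isUnitary_toHeckeCharacter IsConjugateSymplectic)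
open Summit.HodgeConjecture.HodgeConjecture.Cruxes.HLiu418.K2LiuSiegelUnipotentLocalDefs
open Summit.HodgeConjecture.HodgeConjecture.Cruxes.HLiu418.K2LiuSiegelUnipotentSplitAtDefs
open Summit.HodgeConjecture.HodgeConjecture.Cruxes.HLiu418.K2LiuSiegelUnipotentFourierDefs
open Summit.HodgeConjecture.HodgeConjecture.Cruxes.HLiu418.K2LiuSiegelEisensteinKindWLetters (kindWPlaces kindWFinset)
open Summit.HodgeConjecture.HodgeConjecture.Cruxes.HLiu418.K2LiuSiegelEisensteinKindWPartOfLetters (hPart_of_letters)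
open Summit.HodgeConjecture.HodgeConjecture.Cruxes.HLiu418.K2LiuKindWBlockOfRecordCMOfLetters (kindW_block_cm_of_letters)

namespace Summit.HodgeConjecture.HodgeConjecture.Cruxes.HLiu418.K2LiuKindWBlockOfRecordCMOfLocalLetters

set_option maxHeartbeats 400000 in -- MEASURED (as ★ p863299 ∕ ★ (x-a) ED. 4 ∕ ★ `hPart_of_letters`, whose `hint` binder this head carries: the default 200 000 fails at `isDefEq` of the statement; 400 000 passes); projections + one term
/-- **THE KIND-W PAYER HEAD WITH ITS CARRIERS BUILT INSIDE, `hJ hfsupp hfsize harch` DISCHARGED BY NAME, OVER LOCAL LETTERS** (`hPart` PAID by ★ `hPart_of_letters`).  At ★ p862959's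
frame and the TOP's `νN`, for `μ̃ = toHeckeCharacter L lam⁻¹` with `lam` conjugate symplectic (`hlam`): there are a bad set `T₀`, local carriers `νv` (Haar, σ-finite, normalised on
`K_{H,v} ∩ N_Δ(L⁺_v)`), archimedean carriers `νinf T` (σ-finite) with the factorisation of `νN` at every finite `T`, `μ̃` unramified off `T₀`, such that FOR EVERY choice of the
remaining by-value letters — the split families `fT hfac`; the Σ⊗ structure of the `T`-part `FinfT FvT hsum`, summand integrability `hint`, the continued local letters `Finf Ffin`
EQUAL to the summands' archimedean ∕ local Whittaker integrals on `{n∕2 < re s}` (`hFinfI hFfinI`) and holomorphic on `{0 < re s}` (`hFinf hFfin`), the convention `hFinf0`; the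
(iii-fin) per-place level ∕ size letters; the (iii-arch) index ∕ archimedean frames and the pointwise block letter `hBL` — the TOP's 13-slot KIND-W block holds.
Proof: projections of ★ `kindW_block_cm_of_letters` + ★ `hPart_of_letters`.
[cite: KudlaRallis1994, §1–§2] [cite: Tan1999, §2–§3, §4 Prop. 4.8] [cite: Shimura1982, §3] [cite: Shimura1997, §18.4 Prop. 18.14, §19] [cite: CasselsFrohlichANT1967, Ch. XV (Tate) §3.3]
[cite: MoeglinWaldspurger1995, II.1.7, IV.1.9] -/
theorem kindW_block_cm_of_localLetters
    (L : Type) [Field L] [NumberField L] [IsCMField L] {n : ℕ} (e : Fin 2 × Fin 1 ≃ Fin n)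
    (dV : Fin 2 → L) (hdV : ∀ i, IsCMField.complexConj L (dV i) = dV i) (hdV0 : ∀ i, dV i ≠ 0)
    (dW : Fin 1 → L) (hdW : ∀ i, IsCMField.complexConj L (dW i) = dW i) (hdW0 : ∀ i, dW i ≠ 0)
    (lam : IdeleClassGroup L →ₜ* Circle) (hlam : IsConjugateSymplectic L lam)
    (𝒦 : IwasawaDatum L e dV hdV dW hdW) (f : ℂ → HA L e dV hdV dW hdW → ℂ)
    (hstd : IsStandardSectionFamily 𝒦 (toHeckeCharacter L lam⁻¹) f) (hcont : ∀ s, Continuous (f s))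
    [MeasurableSpace (unipDelta L e dV hdV dW hdW)] [BorelSpace (unipDelta L e dV hdV dW hdW)]
    (νN : Measure (unipDelta L e dV hdV dW hdW)) [νN.IsHaarMeasure]
    [DecidableEq (HeightOneSpectrum (𝓞 (Fp L)))]
    [MeasurableSpace (unipDeltaArch L e dV hdV dW hdW)] [BorelSpace (unipDeltaArch L e dV hdV dW hdW)]
    [∀ v : HeightOneSpectrum (𝓞 (Fp L)), MeasurableSpace (unipDeltaLoc L e dV hdV dW hdW v)]
    [∀ v : HeightOneSpectrum (𝓞 (Fp L)), BorelSpace (unipDeltaLoc L e dV hdV dW hdW v)] :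
    ∃ (T₀ : Finset (HeightOneSpectrum (𝓞 (Fp L))))
      (νv : ∀ v : HeightOneSpectrum (𝓞 (Fp L)), Measure (unipDeltaLoc L e dV hdV dW hdW v)) (_ : ∀ v, (νv v).IsHaarMeasure) (_ : ∀ v, SigmaFinite (νv v))
      (νinf : Finset (HeightOneSpectrum (𝓞 (Fp L))) → Measure (unipDeltaArch L e dV hdV dW hdW)) (_ : ∀ T, SigmaFinite (νinf T)),
      (∀ v, νv v (((inH (fun v => UnitaryGroup.localInt L (IsCMField.complexConj L) (n + n) (hermD L e dV hdV dW hdW) v)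
      (fun v => unipDeltaLoc L e dV hdV dW hdW v) v) : Subgroup (unipDeltaLoc L e dV hdV dW hdW v)) : Set (unipDeltaLoc L e dV hdV dW hdW v)) = 1) ∧
      (∀ T : Finset (HeightOneSpectrum (𝓞 (Fp L))), Measure.map (unipDeltaSplitAt L e dV hdV dW hdW T) νN =
      (νinf T).prod ((Measure.pi fun v : T => νv v.1).prod
        (rpMeasure (fun v : {v : HeightOneSpectrum (𝓞 (Fp L)) // v ∉ T} => ((inH (fun v => UnitaryGroup.localInt L (IsCMField.complexConj L) (n + n) (hermD L e dV hdV dW hdW) v)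
          (fun v => unipDeltaLoc L e dV hdV dW hdW v) v.1 : Subgroup (unipDeltaLoc L e dV hdV dW hdW v.1)) : Set (unipDeltaLoc L e dV hdV dW hdW v.1))) (fun v => νv v.1) ∅))) ∧
      (∀ v, v ∉ T₀ → ∀ w' : UnitaryGroup.PlacesOver L v, (toHeckeCharacter L lam⁻¹).IsUnramifiedAt w'.1) ∧
    ∀
        {fT : ∀ T : Finset (HeightOneSpectrum (𝓞 (Fp L))), ℂ → UnitaryGroup.arch (Fp L) L (IsCMField.complexConj L) (n + n) (hermD L e dV hdV dW hdW) ×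
          (Π v : T, UnitaryGroup.localPi L (IsCMField.complexConj L) (n + n) (hermD L e dV hdV dW hdW) v.1) → ℂ}
        (hfac : ∀ T : Finset (HeightOneSpectrum (𝓞 (Fp L))), T₀ ⊆ T → IsFactorizableOff L e dV hdV dW hdW T (toHeckeCharacter L lam⁻¹) f (fT T))
        -- the Σ⊗ STRUCTURE of the `T`-part at `U(S,h)` (`FinfT FvT hsum`), summand integrability `hint`, the CONTINUED local letters `Finf Ffin` (by value) EQUAL to the
        -- summands' archimedean ∕ local Whittaker integrals on `{n∕2 < re s}` (`hFinfI hFfinI`), holomorphic on `{0 < re s}` (`hFinf hFfin`) — ★ (x-a) ED. 4's letters verbatim —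
        -- and the convention `hFinf0` at singular indices (★ p863137's input)
        {m : ℕ}
        (FinfT : Fin m → skewMatrices ((IsCMField.complexConj L : L ≃ₐ[Fp L] L) : L →+* L) ((gramR L e dV hdV dW hdW).map (algebraMap (Fp L) L)) → HA L e dV hdV dW hdW → ℂ → UnitaryGroup.arch (Fp L) L (IsCMField.complexConj L) (n + n) (hermD L e dV hdV dW hdW) → ℂ)
        (FvT : Fin m → ∀ (S : skewMatrices ((IsCMField.complexConj L : L ≃ₐ[Fp L] L) : L →+* L) ((gramR L e dV hdV dW hdW).map (algebraMap (Fp L) L))) (h : HA L e dV hdV dW hdW) (v : (kindWFinset L e dV hdV dW hdW T₀ (S : Matrix (Fin n) (Fin n) L) h)), ℂ → UnitaryGroup.localPi L (IsCMField.complexConj L) (n + n) (hermD L e dV hdV dW hdW) v.1 → ℂ)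
        (hsum : ∀ (S : skewMatrices ((IsCMField.complexConj L : L ≃ₐ[Fp L] L) : L →+* L) ((gramR L e dV hdV dW hdW).map (algebraMap (Fp L) L))) (h : HA L e dV hdV dW hdW) (s : ℂ) (a : UnitaryGroup.arch (Fp L) L (IsCMField.complexConj L) (n + n) (hermD L e dV hdV dW hdW)) (x : Π v : (kindWFinset L e dV hdV dW hdW T₀ (S : Matrix (Fin n) (Fin n) L) h), UnitaryGroup.localPi L (IsCMField.complexConj L) (n + n) (hermD L e dV hdV dW hdW) v.1),
          fT (kindWFinset L e dV hdV dW hdW T₀ (S : Matrix (Fin n) (Fin n) L) h) s (a, x) = ∑ j, FinfT j S h s a * ∏ v : (kindWFinset L e dV hdV dW hdW T₀ (S : Matrix (Fin n) (Fin n) L) h), FvT j S h v s (x v))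
        (hint : ∀ (S : skewMatrices ((IsCMField.complexConj L : L ≃ₐ[Fp L] L) : L →+* L) ((gramR L e dV hdV dW hdW).map (algebraMap (Fp L) L))) (h : HA L e dV hdV dW hdW) (s : ℂ) (j : Fin m), (n : ℝ) / 2 < s.re → (S : Matrix (Fin n) (Fin n) L).det ≠ 0 →
          Integrable (fun p : ↥(unipDeltaArch L e dV hdV dW hdW) × (Π v : (kindWFinset L e dV hdV dW hdW T₀ (S : Matrix (Fin n) (Fin n) L) h), ↥(unipDeltaLoc L e dV hdV dW hdW v.1)) =>
          (conj (unipDeltaChar L e dV hdV dW hdW (S : Matrix (Fin n) (Fin n) L)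
                (UnitaryGroup.archToAdelic (Fp L) L (IsCMField.complexConj L) (n + n) (hermD L e dV hdV dW hdW)
                  (p.1 : UnitaryGroup.arch (Fp L) L (IsCMField.complexConj L) (n + n) (hermD L e dV hdV dW hdW))) : ℂ) *
              ∏ v : (kindWFinset L e dV hdV dW hdW T₀ (S : Matrix (Fin n) (Fin n) L) h), conj (unipDeltaChar L e dV hdV dW hdW (S : Matrix (Fin n) (Fin n) L)
                (locToAdelic L e dV hdV dW hdW v.1
                  ((p.2 v : ↥(unipDeltaLoc L e dV hdV dW hdW v.1)) : UnitaryGroup.localPi L (IsCMField.complexConj L) (n + n) (hermD L e dV hdV dW hdW) v.1)) : ℂ)) *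
            (FinfT j S h s (UnitaryGroup.archPart (Fp L) L (IsCMField.complexConj L) (n + n) (hermD L e dV hdV dW hdW) (weylDelta L e dV hdV dW hdW) *
                  (p.1 : UnitaryGroup.arch (Fp L) L (IsCMField.complexConj L) (n + n) (hermD L e dV hdV dW hdW)) *
                  UnitaryGroup.archPart (Fp L) L (IsCMField.complexConj L) (n + n) (hermD L e dV hdV dW hdW) h) *
              ∏ v : (kindWFinset L e dV hdV dW hdW T₀ (S : Matrix (Fin n) (Fin n) L) h), FvT j S h v s (UnitaryGroup.evalPlace (Fp L) L (IsCMField.complexConj L) (n + n) (hermD L e dV hdV dW hdW) v.1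
                    (UnitaryGroup.finPart (Fp L) L (IsCMField.complexConj L) (n + n) (hermD L e dV hdV dW hdW) (weylDelta L e dV hdV dW hdW)) *
                  ((p.2 v : ↥(unipDeltaLoc L e dV hdV dW hdW v.1)) : UnitaryGroup.localPi L (IsCMField.complexConj L) (n + n) (hermD L e dV hdV dW hdW) v.1) *
                  UnitaryGroup.evalPlace (Fp L) L (IsCMField.complexConj L) (n + n) (hermD L e dV hdV dW hdW) v.1
                    (UnitaryGroup.finPart (Fp L) L (IsCMField.complexConj L) (n + n) (hermD L e dV hdV dW hdW) h)))) ((νinf (kindWFinset L e dV hdV dW hdW T₀ (S : Matrix (Fin n) (Fin n) L) h)).prod (Measure.pi fun v : (kindWFinset L e dV hdV dW hdW T₀ (S : Matrix (Fin n) (Fin n) L) h) => νv v.1)))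
        (Finf : Fin m → skewMatrices ((IsCMField.complexConj L : L ≃ₐ[Fp L] L) : L →+* L) ((gramR L e dV hdV dW hdW).map (algebraMap (Fp L) L)) → ℂ → HA L e dV hdV dW hdW → ℂ)
        (Ffin : Fin m → skewMatrices ((IsCMField.complexConj L : L ≃ₐ[Fp L] L) : L →+* L) ((gramR L e dV hdV dW hdW).map (algebraMap (Fp L) L)) → HA L e dV hdV dW hdW → HeightOneSpectrum (𝓞 (Fp L)) → ℂ → ℂ)
        (hFinfI : ∀ (j : Fin m) (S : skewMatrices ((IsCMField.complexConj L : L ≃ₐ[Fp L] L) : L →+* L) ((gramR L e dV hdV dW hdW).map (algebraMap (Fp L) L))) (h : HA L e dV hdV dW hdW) (s : ℂ), (n : ℝ) / 2 < s.re → (S : Matrix (Fin n) (Fin n) L).det ≠ 0 →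
          Finf j S s h = ∫ a, conj (unipDeltaChar L e dV hdV dW hdW (S : Matrix (Fin n) (Fin n) L)
                (UnitaryGroup.archToAdelic (Fp L) L (IsCMField.complexConj L) (n + n) (hermD L e dV hdV dW hdW)
                  (a : UnitaryGroup.arch (Fp L) L (IsCMField.complexConj L) (n + n) (hermD L e dV hdV dW hdW))) : ℂ) *
              FinfT j S h s (UnitaryGroup.archPart (Fp L) L (IsCMField.complexConj L) (n + n) (hermD L e dV hdV dW hdW) (weylDelta L e dV hdV dW hdW) *
                  (a : UnitaryGroup.arch (Fp L) L (IsCMField.complexConj L) (n + n) (hermD L e dV hdV dW hdW)) *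
                  UnitaryGroup.archPart (Fp L) L (IsCMField.complexConj L) (n + n) (hermD L e dV hdV dW hdW) h) ∂(νinf (kindWFinset L e dV hdV dW hdW T₀ (S : Matrix (Fin n) (Fin n) L) h)))
        (hFfinI : ∀ (j : Fin m) (S : skewMatrices ((IsCMField.complexConj L : L ≃ₐ[Fp L] L) : L →+* L) ((gramR L e dV hdV dW hdW).map (algebraMap (Fp L) L))) (h : HA L e dV hdV dW hdW) (v : (kindWFinset L e dV hdV dW hdW T₀ (S : Matrix (Fin n) (Fin n) L) h)) (s : ℂ), (n : ℝ) / 2 < s.re → (S : Matrix (Fin n) (Fin n) L).det ≠ 0 →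
          Ffin j S h v.1 s = ∫ y, conj (unipDeltaChar L e dV hdV dW hdW (S : Matrix (Fin n) (Fin n) L)
                (locToAdelic L e dV hdV dW hdW v.1
                  ((y : ↥(unipDeltaLoc L e dV hdV dW hdW v.1)) : UnitaryGroup.localPi L (IsCMField.complexConj L) (n + n) (hermD L e dV hdV dW hdW) v.1)) : ℂ) *
              FvT j S h v s (UnitaryGroup.evalPlace (Fp L) L (IsCMField.complexConj L) (n + n) (hermD L e dV hdV dW hdW) v.1
                    (UnitaryGroup.finPart (Fp L) L (IsCMField.complexConj L) (n + n) (hermD L e dV hdV dW hdW) (weylDelta L e dV hdV dW hdW)) *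
                  ((y : ↥(unipDeltaLoc L e dV hdV dW hdW v.1)) : UnitaryGroup.localPi L (IsCMField.complexConj L) (n + n) (hermD L e dV hdV dW hdW) v.1) *
                  UnitaryGroup.evalPlace (Fp L) L (IsCMField.complexConj L) (n + n) (hermD L e dV hdV dW hdW) v.1
                    (UnitaryGroup.finPart (Fp L) L (IsCMField.complexConj L) (n + n) (hermD L e dV hdV dW hdW) h)) ∂(νv v.1))
        (hFinf : ∀ j S (h : HA L e dV hdV dW hdW), DifferentiableOn ℂ (fun s => Finf j S s h) {s : ℂ | 0 < s.re})
        (hFfin : ∀ j S (h : HA L e dV hdV dW hdW) v, DifferentiableOn ℂ (Ffin j S h v) {s : ℂ | 0 < s.re})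
        (hFinf0 : ∀ (j : Fin m) (S : skewMatrices ((IsCMField.complexConj L : L ≃ₐ[Fp L] L) : L →+* L) ((gramR L e dV hdV dW hdW).map (algebraMap (Fp L) L)))
          (s : ℂ) (h : HA L e dV hdV dW hdW), (S : Matrix (Fin n) (Fin n) L).det = 0 → Finf j S s h = 0)
        -- (iii-fin) THE PER-PLACE LEVEL LETTERS (★ p863047 `hfsupp_of_levelLetters`' inputs at the data of record)
        (lev : HA L e dV hdV dW hdW → HeightOneSpectrum (𝓞 L) → ℕ) (Tδ₀ : Finset (HeightOneSpectrum (𝓞 L))) (δ₀ : HeightOneSpectrum (𝓞 L) → ℕ) (hδ₀ : ∀ w ∉ Tδ₀, δ₀ w = 0) (k : ℕ)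
        (hlev : ∀ (h : HA L e dV hdV dW hdW) (w : HeightOneSpectrum (𝓞 L)),
          ((Ideal.absNorm w.asIdeal : ℕ) : ℝ) ^ lev h w ≤ ((Ideal.absNorm w.asIdeal : ℕ) : ℝ) ^ δ₀ w * (GLn.localHeight (n + n) L w (h : GL (Fin (n + n)) (AdeleRing (𝓞 L) L)) : ℝ) ^ k)
        (Tc : Finset (HeightOneSpectrum (𝓞 L))) (c : HeightOneSpectrum (𝓞 L) → ℕ) (hc : ∀ w ∉ Tc, c w = 0)
        (hsuppLoc : ∀ (v : HeightOneSpectrum (𝓞 (Fp L))) (j : Fin m)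
          (S : skewMatrices ((IsCMField.complexConj L : L ≃ₐ[Fp L] L) : L →+* L) ((gramR L e dV hdV dW hdW).map (algebraMap (Fp L) L))) (s : ℂ) (h : HA L e dV hdV dW hdW),
          v ∈ kindWFinset L e dV hdV dW hdW T₀ (S : Matrix (Fin n) (Fin n) L) h → 0 < s.re → Ffin j S h v s ≠ 0 →
          ∀ (w : UnitaryGroup.PlacesOver L v) (a b : Fin n),
            Valued.v ((((S : Matrix (Fin n) (Fin n) L) a b : L)) : w.1.adicCompletion L) ≤ WithZero.exp (((lev h w.1 + c w.1 : ℕ) : ℤ)))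
        -- (iii-fin) THE PER-PLACE SIZE LETTERS (★ p863047 `hfsize_of_placeLetters`' inputs at the data of record, `τ S := ‖(ι_∞ S_{ij})‖`)
        (k₂ k₃ : ℕ) (Tβ : Finset (HeightOneSpectrum (𝓞 L)))
        (hsizeLoc : ∀ z : ℂ, 0 < z.re → ∃ (r : ℝ) (k₁ : ℕ) (β : HeightOneSpectrum (𝓞 L) → ℕ), 0 < r ∧ (∀ w ∉ Tβ, β w = 0) ∧
          ∀ (j : Fin m) (S : skewMatrices ((IsCMField.complexConj L : L ≃ₐ[Fp L] L) : L →+* L) ((gramR L e dV hdV dW hdW).map (algebraMap (Fp L) L))) (s : ℂ),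
          dist s z < r → ∀ (h : HA L e dV hdV dW hdW) (v : HeightOneSpectrum (𝓞 (Fp L))), v ∈ kindWFinset L e dV hdV dW hdW T₀ (S : Matrix (Fin n) (Fin n) L) h →
          ∀ (dS dA : HeightOneSpectrum (𝓞 L) → ℕ),
            (∀ (w : UnitaryGroup.PlacesOver L v) (a b : Fin n), Valued.v ((((S : Matrix (Fin n) (Fin n) L) a b : L)) : w.1.adicCompletion L) ≤ WithZero.exp ((dS w.1 : ℕ) : ℤ)) →
            (∀ (w : UnitaryGroup.PlacesOver L v) (a b : Fin n), Valued.v ((((S : Matrix (Fin n) (Fin n) L)⁻¹ a b : L)) : w.1.adicCompletion L) ≤ WithZero.exp ((dA w.1 : ℕ) : ℤ)) →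
            ‖Ffin j S h v s‖ ≤ ∏ w : UnitaryGroup.PlacesOver L v,
              ((Ideal.absNorm w.1.asIdeal : ℕ) : ℝ) ^ β w.1 * (GLn.localHeight (n + n) L w.1 (h : GL (Fin (n + n)) (AdeleRing (𝓞 L) L)) : ℝ) ^ k₁ *
                ((Ideal.absNorm w.1.asIdeal : ℕ) : ℝ) ^ (k₂ * dS w.1 + k₃ * dA w.1))
        -- (iii-arch) THE INDEX FRAMES (★ FILE 2d), THE ARCHIMEDEAN FRAMES (★ G7-C), AND THE POINTWISE BLOCK LETTER («Φ6b-ind»; ★ p863137 `harch_of_blockLetters`' inputs)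
        {Sinf : Type} [Fintype Sinf]
        (φ : Sinf → (L →+* ℂ)) (A B Ainv Binv : Sinf → Matrix (Fin n) (Fin n) ℂ) {Mf : ℝ} (hMf : 1 ≤ Mf)
        (hA : ∀ σ i j, ‖A σ i j‖ ≤ Mf) (hB : ∀ σ i j, ‖B σ i j‖ ≤ Mf) (hAe : ∀ σ i j, ‖Ainv σ i j‖ ≤ Mf) (hBe : ∀ σ i j, ‖Binv σ i j‖ ≤ Mf)
        (hAi : ∀ σ, Ainv σ * A σ = 1) (hBi : ∀ σ, B σ * Binv σ = 1) (hcover : ∀ w : InfinitePlace L, ∃ σ, InfinitePlace.mk (φ σ) = w)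
        (w : Sinf → {w : InfinitePlace L // IsComplex w}) (hw : ∀ σ, (IsCMField.complexConj L : L ≃ₐ[Fp L] L) • (w σ).1 = (w σ).1)
        (er : Fin n ⊕ Fin n ≃ Fin (n + n)) (T Tinv : Sinf → Matrix (Fin n ⊕ Fin n) (Fin n ⊕ Fin n) ℂ) (hT : ∀ σ, T σ * Tinv σ = 1)
        {M : ℝ} (hM : 1 ≤ M) (hTe : ∀ σ i j, ‖T σ i j‖ ≤ M) (hTe' : ∀ σ i j, ‖Tinv σ i j‖ ≤ M)
        (hBL : ∀ z : ℂ, 0 < z.re → ∃ (cg Ng N'g Kt C a r : ℝ), 0 < cg ∧ 0 ≤ Ng ∧ 0 ≤ N'g ∧ 1 ≤ Kt ∧ 0 ≤ C ∧ 0 ≤ a ∧ 0 < r ∧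
          ∀ (j : Fin m) (S : skewMatrices ((IsCMField.complexConj L : L ≃ₐ[Fp L] L) : L →+* L) ((gramR L e dV hdV dW hdW).map (algebraMap (Fp L) L))) (s : ℂ),
          dist s z < r → (S : Matrix (Fin n) (Fin n) L).det ≠ 0 →
          ∀ (h : HA L e dV hdV dW hdW) (y b d : Sinf → Matrix (Fin n) (Fin n) ℂ) (κ κ' : Sinf → Matrix (Fin n ⊕ Fin n) (Fin n ⊕ Fin n) ℂ),
          (∀ σ, κ σ * κ' σ = 1) → (∀ σ, κ' σ * κ σ = 1) → (∀ σ i j, ‖κ σ i j‖ ≤ M) → (∀ σ i j, ‖κ' σ i j‖ ≤ M) →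
          (∀ σ, T σ * Matrix.reindex er.symm er.symm
              ((((archAt (Fp L) L (IsCMField.complexConj L : L ≃ₐ[Fp L] L) (n + n) (hermD L e dV hdV dW hdW) (w σ) (hw σ) (IsCMField.complexConj_ne_one L)
                  (archPart (Fp L) L (IsCMField.complexConj L : L ≃ₐ[Fp L] L) (n + n) (hermD L e dV hdV dW hdW) h) :
                  archLocal L (n + n) (hermD L e dV hdV dW hdW) (w σ)) : GL (Fin (n + n)) ℂ) : Matrix (Fin (n + n)) (Fin (n + n)) ℂ)) * Tinv σ =
            Matrix.fromBlocks (y σ) (b σ) 0 (d σ) * κ σ) →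
          ∃ t : Sinf → ℝ,
            (∀ σ a b, ‖((y σ)ᴴ * (A σ * ((S : Matrix (Fin n) (Fin n) L).map (φ σ)) * B σ) * y σ) a b‖ ≤ t σ) ∧
            (∀ σ, t σ ≤ Kt * ∑ a, ∑ b, ‖((y σ)ᴴ * (A σ * ((S : Matrix (Fin n) (Fin n) L).map (φ σ)) * B σ) * y σ) a b‖) ∧
            ‖Finf j S s h‖ ≤ C * adelicHeightGL (n + n) L (h : GL (Fin (n + n)) (AdeleRing (𝓞 L) L)) ^ a *
              ∏ σ, (Real.exp (-(cg * t σ)) * (1 + t σ) ^ Ng *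
                (1 + ‖((y σ)ᴴ * (A σ * ((S : Matrix (Fin n) (Fin n) L).map (φ σ)) * B σ) * y σ).det‖ ^ (-N'g)))),
    ∃ (A : skewMatrices ((IsCMField.complexConj L : L ≃ₐ[Fp L] L) : L →+* L) ((gramR L e dV hdV dW hdW).map (algebraMap (Fp L) L)) → ℂ → HA L e dV hdV dW hdW → ℂ)
      (U : skewMatrices ((IsCMField.complexConj L : L ≃ₐ[Fp L] L) : L →+* L) ((gramR L e dV hdV dW hdW).map (algebraMap (Fp L) L)) → HA L e dV hdV dW hdW →
        Set (HeightOneSpectrum (𝓞 ↥(maximalRealSubfield L)))),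
      (∀ S : skewMatrices ((IsCMField.complexConj L : L ≃ₐ[Fp L] L) : L →+* L) ((gramR L e dV hdV dW hdW).map (algebraMap (Fp L) L)),
        (S : Matrix (Fin n) (Fin n) L).det ≠ 0 → ∀ (s : ℂ) (h : HA L e dV hdV dW hdW), (n : ℝ) / 2 < s.re →
          whittakerDelta L e dV hdV dW hdW νN (S : Matrix (Fin n) (Fin n) L) (f s) h =
            A S s h * (partialStandardL (U S h) (fun _ => {1}) (2 * s + 1) *
              partialStandardL (U S h) (fun v => {(quadraticHeckeCharCM L).valueAtUniformizer v}) (2 * s + 2))⁻¹) ∧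
      (∀ S (h : HA L e dV hdV dW hdW), DifferentiableOn ℂ (fun s => A S s h) {s : ℂ | 0 < s.re}) ∧
      ∃ (τ : skewMatrices ((IsCMField.complexConj L : L ≃ₐ[Fp L] L) : L →+* L) ((gramR L e dV hdV dW hdW).map (algebraMap (Fp L) L)) → ℝ) (NW : ℕ),
        (∀ S : skewMatrices ((IsCMField.complexConj L : L ≃ₐ[Fp L] L) : L →+* L) ((gramR L e dV hdV dW hdW).map (algebraMap (Fp L) L)),
          ‖(fun i j => NumberField.mixedEmbedding L ((S : Matrix (Fin n) (Fin n) L) i j))‖ ≤ τ S) ∧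
        (∀ z : ℂ, 0 < z.re → ∃ C a c a' r : ℝ, 0 ≤ C ∧ 0 ≤ a ∧ 0 < c ∧ 0 ≤ a' ∧ 0 < r ∧ ∀ S (s : ℂ), dist s z < r → ∀ h : HA L e dV hdV dW hdW,
          ‖A S s h‖ ≤ C * adelicHeightGL (n + n) L (h : GL (Fin (n + n)) (AdeleRing (𝓞 L) L)) ^ a *
            (Real.exp (-(c * adelicHeightGL (n + n) L (h : GL (Fin (n + n)) (AdeleRing (𝓞 L) L)) ^ (-a') * τ S)) * (1 + τ S) ^ NW)) ∧
        ∃ CW κ : ℝ, 0 < CW ∧ 0 ≤ κ ∧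
          ∀ S (s : ℂ) (h : HA L e dV hdV dW hdW), 0 < s.re → A S s h ≠ 0 →
            ∃ D : ℕ, 1 ≤ D ∧ (D : ℝ) ≤ CW * adelicHeightGL (n + n) L (h : GL (Fin (n + n)) (AdeleRing (𝓞 L) L)) ^ κ ∧
              ∀ i j, IsIntegral ℤ ((D : L) * (S : Matrix (Fin n) (Fin n) L) i j) := by
  -- the carriers and the ∀-head of ★ `kindW_block_cm_of_letters`, unpacked by projections (an `obtain` on this instance-laden goal times out, as in ★ `kindW_block_cm`)
  have h := kindW_block_cm_of_letters L e dV hdV hdV0 dW hdW hdW0 lam hlam 𝒦 f hstd hcont νN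
  have h1 := h.choose_spec
  have h2 := h1.choose_spec
  have h3 := h2.choose_spec
  have h4 := h3.choose_spec
  have h5 := h4.choose_spec
  have h6 := h5.choose_spec
  refine ⟨h.choose, h1.choose, h2.choose, h3.choose, h4.choose, h5.choose, h6.1, h6.2.1, h6.2.2.1, ?_⟩
  intro fT hfac m FinfT FvT hsum hint Finf Ffin hFinfI hFfinI hFinf hFfin hFinf0 lev Tδ₀ δ₀ hδ₀ k hlev Tc c hc hsuppLoc k₂ k₃ Tβ hsizeLoc Sinf _ φ A B Ainv Binv Mf hMf
    hA hB hAe hBe hAi hBi hcover w hw er T Tinv hT M hM hTe hTe' hBL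
  haveI := h2.choose
  haveI := h3.choose
  exact h6.2.2.2 hfac Finf Ffin hFinf hFfin hFinf0 (hPart_of_letters L e dV hdV dW hdW h.choose h4.choose h5.choose h1.choose FinfT FvT hsum hint Finf Ffin hFinfI hFfinI)
    lev Tδ₀ δ₀ hδ₀ k hlev Tc c hc hsuppLoc k₂ k₃ Tβ hsizeLoc φ A B Ainv Binv hMf hA hB hAe hBe hAi hBi hcover w hw er T Tinv hT hM hTe hTe' hBL

end Summit.HodgeConjecture.HodgeConjecture.Cruxes.HLiu418.K2LiuKindWBlockOfRecordCMOfLocalLetters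

end
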